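import Summits.Parity.GeneralizedHardyLittlewood.Theorems.PrimeLevelFamEdgeMomentsBeyondDiagonalDiagDecorProfileCoord
import HarnessLib

/-!
# Route `PrimeLevelFamEdge`, crux K_A `MomentsBeyondDiagonal` (stmt-Parity-20007), line «petersson_layers» v4, stub `stub_diag`:
# **generic `(log k)^σ` shift of a decorated `k`-engine, and the profile layer with a SHIFTED main exponent `t + c − s`**

Census R3(ii), ANALYTIC HALF — item 1 of the remaining list in
`Cruxes/MomentsBeyondDiagonal/Lines/petersson_layers_stub_diag_g9_decor.md`. The monomials of the per-order weights carry
plain powers `(log k)^σ` next to the divisor decorations `t(k) ∈ {τ, τ_{1,0}, τ_{1,1}, τ_{2,0}, …}`; `log k = log y − log(y/k)`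
turns the `(log k)^σ t(k)`-weighted coprime sum into a binomial combination of the `t`-engines at the orders `c + β`
(exactly as `…DiagDecorLogPow` does for `t = τ`), after which the main exponent is `σ + c − s` — possibly ABOVE `c`, so the
profile layer `…DiagDecorProfileCoord.abs_profileLayer_sub_le` (main exponent `c − s`) is re-run with a shift `t`:

* `abs_kSum_logPow_shift_sub_le` — **generic engine shift**: if `|Σ_{k≤y} w_n(k)logᶜ(y/k) − m_c E_n log^{c−s}y| ≤
  K_c D(n)(1+κ(n))(1+log y)^{c−s−1}` for every `c ≥ 2` (`s ≤ 1`), then for every `σ` and `c ≥ 2`: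
  `|Σ_{k≤y} w_n(k)(log k)^σ logᶜ(y/k) − (Σ_β C(σ,β)(−1)^β m_{c+β})·E_n·log^{σ+c−s}y| ≤ C·D(n)(1+κ(n))(1+log y)^{σ+c−s}/(1+log y)`;
* `abs_profileLayer_shift_sub_le` — **profile layer, shifted**: if `|S n y c − m_c E_n log^{t+c−s}y| ≤
  K_c D(n)(1+κ(n))(1+log y)^{t+c−s}/(1+log y)` for every `c ≥ 2` (`s ≤ 1`), then for `P₀ = P₁ = 0`, `M ≥ 3`, `1 ≤ n ≤ M`:
  `|Σ_c P_c S n (M/n) c/logᶜM − E_n Σ_c P_c m_c log^{t+c−s}(M/n)/logᶜM| ≤ C_P·D(n)(1+κ(n))·log^tM/log^{s+1}M`.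

Chaining (`t = σ`): the `(log k)^σ t(k)`-decorated profile coordinate is `E_n·log^{σ−s}M·R(u_n) + O(D(1+κ)log^{σ−s−1}M)`
with `R(u) = Σ_c P_c(Σ_β C(σ,β)(−1)^β m_{c+β})u^{σ+c−s}`; when `σ ≤ s` this is the master-step format of
`…DiagDecorBilinearTwoScale` with shift `s − σ`. Def-free; theorems only. Helper `--supports stmt-Parity-20007`; closes
nothing; K_A, K_B and the Parity summit are NOT proved; nothing about Landau–Siegel zeros.

## References
* E. Kowalski, P. Michel, J. VanderKam, J. reine angew. Math. 526 (2000), (23)–(28) pp. 13–15 and Prop. 5.1 p. 18.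
  [cite: KowalskiMichelVanderKam2000, (23)–(28) — derivation (log k powers of the diagonal main term)]
-/

noncomputable section

open scoped Real ArithmeticFunction.Moebius
open Finset ArithmeticFunction Polynomial

namespace Summit.Parity.GeneralizedHardyLittlewood.Theorems.MomentsBeyondDiagonal.DiagKernel

open Literature.NumberTheory.LFunctions Literature.NumberTheory.LFunctions.KMV2000
open SelbergCoord (kappa)
open Literature.NumberTheory.Sieve (one_le_log_of_three_le)
open Summit.Parity.GeneralizedHardyLittlewood.Theorems.BeyondDiagonalBeatsQuarter.KernelFormXSq
  (mainConst divWeight divWeight_nonneg mainConst_nonneg)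
open Summit.Parity.GeneralizedHardyLittlewood.Theorems.MomentsBeyondDiagonal.DiagLines
  (sum_mul_log_pow_mul_log_div_pow_eq)

/-! ### The generic engine shift -/

/-- **Generic `(log k)^σ` shift of a decorated `k`-engine** (see the module docstring).
[cite: KowalskiMichelVanderKam2000, (23)–(28) — derivation (log k powers)] -/
theorem abs_kSum_logPow_shift_sub_le (w : ℕ → ℕ → ℝ) (m : ℕ → ℝ) {s : ℕ} (hs : s ≤ 1)
    (hw : ∀ c : ℕ, 2 ≤ c → ∃ K : ℝ, 0 < K ∧ ∀ n : ℕ, n ≠ 0 → ∀ y : ℝ, 1 ≤ y →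
      |∑ k ∈ Icc 1 ⌊y⌋₊, w n k * Real.log (y / k) ^ c - m c * mainConst n * Real.log y ^ (c - s)| ≤
        K * divWeight n * (1 + kappa n) * (1 + Real.log y) ^ (c - s - 1))
    (a : ℕ) {c : ℕ} (hc : 2 ≤ c) :
    ∃ C : ℝ, 0 < C ∧ ∀ n : ℕ, n ≠ 0 → ∀ y : ℝ, 1 ≤ y →
      |∑ k ∈ Icc 1 ⌊y⌋₊, w n k * Real.log k ^ a * Real.log (y / k) ^ c -
          (∑ β ∈ Finset.range (a + 1), (a.choose β : ℝ) * (-1) ^ β * m (c + β)) * mainConst n *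
            Real.log y ^ (a + c - s)| ≤
        C * divWeight n * (1 + kappa n) * (1 + Real.log y) ^ (a + c - s) / (1 + Real.log y) := by
  -- one constant per order `c + β`
  have hex : ∀ β : ℕ, ∃ C : ℝ, 0 < C ∧ ∀ n : ℕ, n ≠ 0 → ∀ y : ℝ, 1 ≤ y →
      |∑ k ∈ Icc 1 ⌊y⌋₊, w n k * Real.log (y / k) ^ (c + β) -
          m (c + β) * mainConst n * Real.log y ^ (c + β - s)| ≤
        C * (divWeight n * (1 + kappa n)) * (1 + Real.log y) ^ (c + β - s) / (1 + Real.log y) := by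
    intro β
    obtain ⟨K, hK, h⟩ := hw (c + β) (by omega)
    refine ⟨K, hK, fun n hn y hy ↦ ?_⟩
    have hly : 0 ≤ Real.log y := Real.log_nonneg hy
    have hL0 : (0 : ℝ) < 1 + Real.log y := by linarith
    have hne : c + β - s ≠ 0 := by omega
    calc _ ≤ K * divWeight n * (1 + kappa n) * (1 + Real.log y) ^ (c + β - s - 1) := h n hn y hy
      _ = K * (divWeight n * (1 + kappa n)) * (1 + Real.log y) ^ (c + β - s) / (1 + Real.log y) := by
          rw [← pow_sub_one_mul hne (1 + Real.log y)]; field_simp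
  choose Cf hCf0 hCf using hex
  have hS0 : 0 ≤ ∑ β ∈ Finset.range (a + 1), (a.choose β : ℝ) * Cf β :=
    Finset.sum_nonneg fun β _ ↦ mul_nonneg (Nat.cast_nonneg _) (hCf0 β).le
  refine ⟨∑ β ∈ Finset.range (a + 1), (a.choose β : ℝ) * Cf β + 1, by linarith, fun n hn y hy ↦ ?_⟩
  have hy0 : 0 < y := by linarith
  have hly : 0 ≤ Real.log y := Real.log_nonneg hy
  have hL0 : (0 : ℝ) < 1 + Real.log y := by linarith
  have hκ : 0 ≤ kappa n := by
    unfold kappa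
    exact Finset.sum_nonneg fun p hp ↦ by
      have hp2 : (2 : ℝ) ≤ p := by exact_mod_cast (Nat.prime_of_mem_primeFactors hp).two_le
      exact div_nonneg (Real.log_nonneg (by linarith)) (by linarith)
  have hD0 := divWeight_nonneg n
  have hD : 0 ≤ divWeight n * (1 + kappa n) := mul_nonneg hD0 (by linarith)
  -- Step 1: the binomial expansion `log k = log y − log(y/k)`
  have h := sum_mul_log_pow_mul_log_div_pow_eq hy0 (fun k : ℕ ↦ w n k) a c
  beta_reduce at h
  rw [h]
  -- Step 2: termwise differences
  have hmain : (∑ β ∈ Finset.range (a + 1), (a.choose β : ℝ) * (-1) ^ β *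
      m (c + β)) * mainConst n * Real.log y ^ (a + c - s) =
      ∑ β ∈ Finset.range (a + 1), (a.choose β : ℝ) * Real.log y ^ (a - β) * (-1) ^ β *
        (m (c + β) * mainConst n * Real.log y ^ (c + β - s)) := by
    rw [Finset.sum_mul, Finset.sum_mul]
    refine Finset.sum_congr rfl fun β hβ ↦ ?_
    have hβ' : β < a + 1 := Finset.mem_range.1 hβ
    have e : a + c - s = (a - β) + (c + β - s) := by omega
    rw [e, pow_add]
    ring
  rw [hmain, ← Finset.sum_sub_distrib]
  have hterm : ∀ β ∈ Finset.range (a + 1),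
      |(a.choose β : ℝ) * Real.log y ^ (a - β) * (-1) ^ β *
          ∑ k ∈ Icc 1 ⌊y⌋₊, w n k * Real.log (y / k) ^ (c + β) -
        (a.choose β : ℝ) * Real.log y ^ (a - β) * (-1) ^ β *
          (m (c + β) * mainConst n * Real.log y ^ (c + β - s))| ≤
      (a.choose β : ℝ) * Cf β * (divWeight n * (1 + kappa n) * (1 + Real.log y) ^ (a + c - s) / (1 + Real.log y)) := by
    intro β hβ
    have hβ' : β < a + 1 := Finset.mem_range.1 hβ
    rw [← mul_sub, abs_mul, abs_mul, abs_mul, abs_pow, abs_pow, abs_neg, abs_one, one_pow, mul_one,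
      abs_of_nonneg (by positivity : (0 : ℝ) ≤ (a.choose β : ℝ)), abs_of_nonneg hly]
    have hin := hCf β n hn y hy
    have hlog : Real.log y ^ (a - β) ≤ (1 + Real.log y) ^ (a - β) :=
      pow_le_pow_left₀ hly (by linarith) _
    have e : a + c - s = (a - β) + (c + β - s) := by omega
    calc (a.choose β : ℝ) * Real.log y ^ (a - β) *
          |∑ k ∈ Icc 1 ⌊y⌋₊, w n k * Real.log (y / k) ^ (c + β) -
            m (c + β) * mainConst n * Real.log y ^ (c + β - s)|
        ≤ (a.choose β : ℝ) * (1 + Real.log y) ^ (a - β) *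
            (Cf β * (divWeight n * (1 + kappa n)) * (1 + Real.log y) ^ (c + β - s) / (1 + Real.log y)) :=
          mul_le_mul (mul_le_mul_of_nonneg_left hlog (Nat.cast_nonneg _)) hin (abs_nonneg _)
            (by positivity)
      _ = (a.choose β : ℝ) * Cf β * (divWeight n * (1 + kappa n) * (1 + Real.log y) ^ (a + c - s) / (1 + Real.log y)) := by
          rw [e, pow_add]
          field_simp
  -- Step 3: sum the termwise bounds
  calc _ ≤ ∑ β ∈ Finset.range (a + 1),
        |(a.choose β : ℝ) * Real.log y ^ (a - β) * (-1) ^ β *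
            ∑ k ∈ Icc 1 ⌊y⌋₊, w n k * Real.log (y / k) ^ (c + β) -
          (a.choose β : ℝ) * Real.log y ^ (a - β) * (-1) ^ β *
            (m (c + β) * mainConst n * Real.log y ^ (c + β - s))| :=
        Finset.abs_sum_le_sum_abs _ _
    _ ≤ ∑ β ∈ Finset.range (a + 1),
        (a.choose β : ℝ) * Cf β * (divWeight n * (1 + kappa n) * (1 + Real.log y) ^ (a + c - s) / (1 + Real.log y)) :=
        Finset.sum_le_sum hterm
    _ = (∑ β ∈ Finset.range (a + 1), (a.choose β : ℝ) * Cf β) *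
        divWeight n * (1 + kappa n) * (1 + Real.log y) ^ (a + c - s) / (1 + Real.log y) := by
        rw [Finset.sum_mul, Finset.sum_mul, Finset.sum_mul, Finset.sum_div]
        refine Finset.sum_congr rfl fun β _ ↦ by ring
    _ ≤ (∑ β ∈ Finset.range (a + 1), (a.choose β : ℝ) * Cf β + 1) *
        divWeight n * (1 + kappa n) * (1 + Real.log y) ^ (a + c - s) / (1 + Real.log y) := by
        gcongr
        linarith


/-! ### The profile layer with a shifted main exponent -/

/-- **Profile layer, shifted main exponent `t + c − s`** (see the module docstring; `t = 0` is
`…DiagDecorProfileCoord.abs_profileLayer_sub_le` up to the error format). [cite: KowalskiMichelVanderKam2000, Prop. 5.1 — derivation] -/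
theorem abs_profileLayer_shift_sub_le (S : ℕ → ℝ → ℕ → ℝ) (m : ℕ → ℝ) (t : ℕ) {s : ℕ} (hs : s ≤ 1)
    (hS : ∀ c : ℕ, 2 ≤ c → ∃ K : ℝ, 0 < K ∧ ∀ n : ℕ, n ≠ 0 → ∀ y : ℝ, 1 ≤ y →
      |S n y c - m c * mainConst n * Real.log y ^ (t + c - s)| ≤
        K * divWeight n * (1 + kappa n) * (1 + Real.log y) ^ (t + c - s) / (1 + Real.log y))
    (P : ℝ[X]) (hP0 : P.coeff 0 = 0) (hP1 : P.coeff 1 = 0) :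
    ∃ C : ℝ, 0 < C ∧ ∀ M : ℝ, 3 ≤ M → ∀ n : ℕ, n ≠ 0 → (n : ℝ) ≤ M →
      |∑ c ∈ Finset.range (P.natDegree + 1), P.coeff c * (S n (M / n) c / Real.log M ^ c) -
          mainConst n * ∑ c ∈ Finset.range (P.natDegree + 1), P.coeff c *
            (m c * Real.log (M / n) ^ (t + c - s) / Real.log M ^ c)| ≤
        C * divWeight n * (1 + kappa n) * Real.log M ^ t / Real.log M ^ (s + 1) := by
  -- one constant per order (orders `< 2` get a dummy constant)
  have hK : ∀ c : ℕ, ∃ K : ℝ, 0 < K ∧ (2 ≤ c → ∀ n : ℕ, n ≠ 0 → ∀ y : ℝ, 1 ≤ y →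
      |S n y c - m c * mainConst n * Real.log y ^ (t + c - s)| ≤
        K * divWeight n * (1 + kappa n) * (1 + Real.log y) ^ (t + c - s) / (1 + Real.log y)) := by
    intro c
    by_cases hc : 2 ≤ c
    · obtain ⟨K, hK, h⟩ := hS c hc
      exact ⟨K, hK, fun _ ↦ h⟩
    · exact ⟨1, one_pos, fun h ↦ absurd h hc⟩
  choose K hK0 hK using hK
  have hKsum : 0 ≤ ∑ c ∈ Finset.range (P.natDegree + 1), |P.coeff c| * K c * 2 ^ (t + c - s - 1) :=
    Finset.sum_nonneg fun c _ ↦ by have := hK0 c; positivity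
  refine ⟨∑ c ∈ Finset.range (P.natDegree + 1), |P.coeff c| * K c * 2 ^ (t + c - s - 1) + 1, by linarith,
    fun M hM n hn hnM ↦ ?_⟩
  set ℓ := Real.log M with hℓ
  have hℓ1 : 1 ≤ ℓ := one_le_log_of_three_le hM
  have hℓ0 : 0 < ℓ := by linarith
  obtain ⟨hY0, hYℓ⟩ := log_div_nonneg_and_le hM hn hnM
  have hn1 : (1 : ℝ) ≤ n := by exact_mod_cast Nat.one_le_iff_ne_zero.2 hn
  have hy1 : 1 ≤ M / n := (one_le_div (by linarith)).2 hnM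
  have hD := divWeight_nonneg n
  have hκ : 0 ≤ kappa n := by
    unfold kappa
    exact Finset.sum_nonneg fun p hp ↦ by
      have hp2 : (2 : ℝ) ≤ p := by exact_mod_cast (Nat.prime_of_mem_primeFactors hp).two_le
      exact div_nonneg (Real.log_nonneg (by linarith)) (by linarith)
  set Y := Real.log (M / n) with hY
  -- per-order differences
  set d : ℕ → ℝ := fun c ↦ S n (M / n) c / ℓ ^ c - m c * mainConst n * Y ^ (t + c - s) / ℓ ^ c with hd
  have hdiff : ∑ c ∈ Finset.range (P.natDegree + 1), P.coeff c * (S n (M / n) c / ℓ ^ c) -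
      mainConst n * ∑ c ∈ Finset.range (P.natDegree + 1), P.coeff c * (m c * Y ^ (t + c - s) / ℓ ^ c) =
      ∑ c ∈ Finset.range (P.natDegree + 1), P.coeff c * d c := by
    rw [Finset.mul_sum, ← Finset.sum_sub_distrib]
    refine Finset.sum_congr rfl fun c _ ↦ ?_
    simp only [hd]
    ring
  set Z : ℝ := divWeight n * (1 + kappa n) * ℓ ^ t / ℓ ^ (s + 1) with hZ
  have hZ0 : 0 ≤ Z := by positivity
  have hterm : ∀ c ∈ Finset.range (P.natDegree + 1), |P.coeff c * d c| ≤ |P.coeff c| * K c * 2 ^ (t + c - s - 1) * Z := by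
    intro c _
    rw [abs_mul]
    by_cases hc : 2 ≤ c
    · have h := hK c hc n hn (M / n) hy1
      rw [← hY] at h
      have hpow : ℓ ^ (t + c - s - 1) * ℓ ^ (s + 1) = ℓ ^ c * ℓ ^ t := by
        rw [← pow_add, ← pow_add]; congr 1; omega
      have hne : t + c - s ≠ 0 := by omega
      have hdc : |d c| ≤ K c * 2 ^ (t + c - s - 1) * Z := by
        have hd' : d c = (S n (M / n) c - m c * mainConst n * Y ^ (t + c - s)) / ℓ ^ c := by
          simp only [hd]; ring
        rw [hd', abs_div, abs_of_pos (pow_pos hℓ0 c), div_le_iff₀ (pow_pos hℓ0 c)]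
        have hY1 : (0 : ℝ) < 1 + Y := by linarith
        calc |S n (M / n) c - m c * mainConst n * Y ^ (t + c - s)|
            ≤ K c * divWeight n * (1 + kappa n) * (1 + Y) ^ (t + c - s) / (1 + Y) := h
          _ = K c * divWeight n * (1 + kappa n) * (1 + Y) ^ (t + c - s - 1) := by
              rw [← pow_sub_one_mul hne (1 + Y)]; field_simp
          _ ≤ K c * divWeight n * (1 + kappa n) * (2 * ℓ) ^ (t + c - s - 1) := by
              refine mul_le_mul_of_nonneg_left (pow_le_pow_left₀ (by linarith) (by linarith) _) ?_
              have := hK0 c; positivity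
          _ = K c * 2 ^ (t + c - s - 1) * (divWeight n * (1 + kappa n)) * (ℓ ^ (t + c - s - 1)) := by
              rw [mul_pow]; ring
          _ = K c * 2 ^ (t + c - s - 1) * Z * ℓ ^ c := by
              rw [hZ]
              field_simp
              calc K c * divWeight n * ℓ ^ (t + c - s - 1) * ℓ ^ (s + 1)
                  = K c * divWeight n * (ℓ ^ (t + c - s - 1) * ℓ ^ (s + 1)) := by ring
                _ = K c * divWeight n * (ℓ ^ c * ℓ ^ t) := by rw [hpow]
                _ = K c * divWeight n * ℓ ^ t * ℓ ^ c := by ring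
      calc |P.coeff c| * |d c| ≤ |P.coeff c| * (K c * 2 ^ (t + c - s - 1) * Z) :=
            mul_le_mul_of_nonneg_left hdc (abs_nonneg _)
        _ = |P.coeff c| * K c * 2 ^ (t + c - s - 1) * Z := by ring
    · have hc01 : c = 0 ∨ c = 1 := by omega
      have hPc : P.coeff c = 0 := by rcases hc01 with rfl | rfl <;> assumption
      rw [hPc, abs_zero, zero_mul, zero_mul, zero_mul, zero_mul]
  rw [hdiff]
  calc |∑ c ∈ Finset.range (P.natDegree + 1), P.coeff c * d c|
      ≤ ∑ c ∈ Finset.range (P.natDegree + 1), |P.coeff c * d c| := Finset.abs_sum_le_sum_abs _ _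
    _ ≤ ∑ c ∈ Finset.range (P.natDegree + 1), |P.coeff c| * K c * 2 ^ (t + c - s - 1) * Z := Finset.sum_le_sum hterm
    _ = (∑ c ∈ Finset.range (P.natDegree + 1), |P.coeff c| * K c * 2 ^ (t + c - s - 1)) * Z := by rw [Finset.sum_mul]
    _ ≤ (∑ c ∈ Finset.range (P.natDegree + 1), |P.coeff c| * K c * 2 ^ (t + c - s - 1) + 1) * Z := by
        gcongr; linarith
    _ = _ := by rw [hZ]; ring


end Summit.Parity.GeneralizedHardyLittlewood.Theorems.MomentsBeyondDiagonal.DiagKernel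

end
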